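import Summits.CriticalPhenomena.Ising3DConformalLimit.Theses.PerfectScreening
import Summits.CriticalPhenomena.Ising3DConformalLimit.Theses.HyperoctahedralRP
import Summits.CriticalPhenomena.Ising3DConformalLimit.Theorems.EnergyNotSigmaSquaredMoebiusLimitExistsHrpFactorisation
import Summits.CriticalPhenomena.Ising3DConformalLimit.Theorems.HyperoctahedralRPLimitRotationInvariant
import HarnessLib

/-!
# Crux `MoebiusLimitExists` (item stmt-CriticalPhenomena-1344) is the conjunction of TWO open leaves
(line lead c10, 2026-08-17; `--supports stmt-CriticalPhenomena-1344`; glue for a `route edit --split … --glue-by`)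

The crux `PerfectScreening.MoebiusLimitExists` (verbatim `EnergyNotSigmaSquared.MoebiusLimit`,
`AnomalousForcesInteraction.MoebiusLimit`, `GammaForcesInteraction.MoebiusLimit`; shared by eleven routes) —
"the critical Ising correlators on `ℤ³` have a non-degenerate, Möbius-covariant pointwise scaling limit" — is,
by the landed factorisation `MoebiusLimitExists_iff_hrp` (`…HrpFactorisation.lean`), EXACTLY the conjunction of
the three `HyperoctahedralRP` cruxes 1981 ∧ 1980 ∧ 1982.  The middle factor, item stmt-CriticalPhenomena-1980
`HyperoctahedralRP.LimitRotationInvariant` (`O(3)` invariance of every normalised, non-degenerate,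
translation-invariant, scale-covariant pointwise limit, given `HRP2Rigidity`), is now a THEOREM of the tree
(`Cruxes.LimitRotationInvariant.QuarterTurnLiouville.LimitRotationInvariant_of`,
`Theorems/HyperoctahedralRPLimitRotationInvariant.lean`).  Hence the crux is the conjunction of the two OPEN leaves

* `Leaf₁` = item stmt-CriticalPhenomena-1981 `HyperoctahedralRP.ExistsScaleCovariantLimit` — EXISTENCE of a
  normalised, non-degenerate, translation-invariant, scale-covariant pointwise limit of `criticalCorr 3`;
* `Leaf₂` = item stmt-CriticalPhenomena-1982 `HyperoctahedralRP.InversionUpgradeNormalised` — the INVERSION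
  UPGRADE of every normalised, non-degenerate, Euclidean-invariant, scale-covariant pointwise limit.

Main results (pure assembly over landed theorems; no definitions, no `sorry`):

* `MoebiusLimitExists_of_leaves : Leaf₁ → Leaf₂ → PerfectScreening.MoebiusLimitExists` — the glue, of the exact
  shape `C₁ → C₂ → C` wanted by `ledger route edit --split MoebiusLimitExists --glue-by`;
* `MoebiusLimitExists_iff_leaves : MoebiusLimitExists ↔ Leaf₁ ∧ Leaf₂` — each leaf is necessary
  (`existsScaleCovariantLimit_of_MoebiusLimitExists`, `inversionUpgradeNormalised_of_MoebiusLimitExists`);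
* the same two statements for the sibling spellings of item 1344 (`EnergyNotSigmaSquared`,
  `AnomalousForcesInteraction`, `GammaForcesInteraction`) and the two-leaf assembly of crux stmt-4801
  `MoebiusLimitOfTwoPointLaw` (`BernsteinTemperature`, `PrecisionLaplacian`; its two-point-law hypothesis unused);
* `MoebiusLimitExists_iff_inversionUpgrade_of_leaf₁ : Leaf₁ → (MoebiusLimitExists ↔ Leaf₂)` — given existence,
  the crux IS Polyakov's inversion upgrade for the critical `ℤ³` Ising limit.

References: H. Duminil-Copin, *100 years of the (critical) Ising model on the hypercubic lattice*, Proc. ICM 2022,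
§8.1 p. 25 and §8.4 p. 29 (existence and conformal invariance of the `ℤ³` limit: open); A. M. Polyakov, JETP
Lett. 12 (1970) 381 (the inversion upgrade); P. Di Francesco, P. Mathieu, D. Sénéchal, *Conformal Field Theory*
(1997) §4.3.1 eq. (4.62) (Möbius = Euclid + dilations + inversion).
-/

noncomputable section

open Literature.Probability.LatticeModels
open Summit.CriticalPhenomena.Ising3DConformalLimit.Theses
open Summit.CriticalPhenomena.Ising3DConformalLimit.MoebiusLimitExistsOnlyInteraction
  (MoebiusLimitExists_of_hrp existsScaleCovariantLimit_of_MoebiusLimitExists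
    inversionUpgradeNormalised_of_MoebiusLimitExists)
open Summit.CriticalPhenomena.Ising3DConformalLimit.Cruxes.LimitRotationInvariant.QuarterTurnLiouville
  (LimitRotationInvariant_of)

namespace Summit.CriticalPhenomena.Ising3DConformalLimit.MoebiusLimitExistsTwoLeaf

/-! ### The glue `1981 → 1982 → crux` -/

/-- **GLUE of the two-leaf split of crux stmt-1344.**  Existence (item 1981) and the inversion upgrade
(item 1982) give `PerfectScreening.MoebiusLimitExists`: the middle hypothesis of the landed three-factor
assembly `MoebiusLimitExists_of_hrp` — `O(3)` invariance of every normalised scale-covariant limit, item 1980 —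
is the tree theorem `LimitRotationInvariant_of`. [cite: DuminilCopinICM2022, §8.1 p. 25 and §8.4 p. 29] -/
theorem MoebiusLimitExists_of_leaves
    (h1981 : HyperoctahedralRP.ExistsScaleCovariantLimit)
    (h1982 : HyperoctahedralRP.InversionUpgradeNormalised) :
    PerfectScreening.MoebiusLimitExists :=
  MoebiusLimitExists_of_hrp h1981 LimitRotationInvariant_of h1982

/-- **`MoebiusLimitExists ⟺ 1981 ∧ 1982`.**  After the proof of item 1980, crux stmt-1344 is EXACTLY the
conjunction of the two open leaves EXISTENCE (1981) and INVERSION UPGRADE (1982); each leaf is necessary.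
[cite: DuminilCopinICM2022, §8.4 p. 29] -/
theorem MoebiusLimitExists_iff_leaves :
    Theses.PerfectScreening.MoebiusLimitExists ↔
      Theses.HyperoctahedralRP.ExistsScaleCovariantLimit ∧ Theses.HyperoctahedralRP.InversionUpgradeNormalised :=
  ⟨fun h => ⟨existsScaleCovariantLimit_of_MoebiusLimitExists h, inversionUpgradeNormalised_of_MoebiusLimitExists h⟩,
    fun h => MoebiusLimitExists_of_leaves h.1 h.2⟩

/-- **Given existence, the crux IS the inversion upgrade**: under item 1981, `MoebiusLimitExists` is
equivalent to item 1982 (Polyakov's postulate for the critical `ℤ³` Ising limit).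
[cite: DuminilCopinICM2022, §8.4 p. 29] -/
theorem MoebiusLimitExists_iff_inversionUpgrade_of_leaf₁
    (h1981 : HyperoctahedralRP.ExistsScaleCovariantLimit) :
    PerfectScreening.MoebiusLimitExists ↔ HyperoctahedralRP.InversionUpgradeNormalised :=
  ⟨inversionUpgradeNormalised_of_MoebiusLimitExists, MoebiusLimitExists_of_leaves h1981⟩

/-- The unconditional half of item 1980 used above, restated at the crux: every normalised, non-degenerate,
translation-invariant, scale-covariant pointwise scaling limit of `criticalCorr 3` is `O(3)` invariant
(`LimitRotationInvariant_of` fed with the tree theorem `HRP2Rigidity_of`). [cite: DuminilCopinICM2022, §8.4 p. 29] -/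
theorem isRotationInvariant_of_scaleCovariantLimit {ρ : ℝ → ℝ} {Δ : ℝ} {S : CorrFamily 3}
    (hρ : ∀ δ ∈ Set.Ioc (0:ℝ) 1, 0 < ρ δ) (hlim : HasPointwiseScalingLimit (criticalCorr 3) ρ S)
    (hnorm : ∀ n z, z ∉ NonCoincident 3 n → S n z = 0) (hnd : IsNondegenerateTwoPoint S)
    (htr : IsTranslationInvariant S) (hsc : IsScaleCovariant Δ S) : IsRotationInvariant S :=
  LimitRotationInvariant_of
    _root_.Summit.CriticalPhenomena.Ising3DConformalLimit.Cruxes.HRP2Rigidity.XRayMellin.HRP2Rigidity_of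
    ρ Δ S hρ hlim hnorm hnd htr hsc

/-! ### Sibling spellings of item stmt-1344 -/

/-- The glue for the host-route spelling `EnergyNotSigmaSquared.MoebiusLimit` (the same term).
[cite: DuminilCopinICM2022, §8.4 p. 29] -/
theorem MoebiusLimit_of_leaves
    (h1981 : HyperoctahedralRP.ExistsScaleCovariantLimit)
    (h1982 : HyperoctahedralRP.InversionUpgradeNormalised) :
    EnergyNotSigmaSquared.MoebiusLimit :=
  MoebiusLimitExists_of_leaves h1981 h1982

/-- The two-leaf factorisation for `EnergyNotSigmaSquared.MoebiusLimit`. [cite: DuminilCopinICM2022, §8.4 p. 29] -/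
theorem MoebiusLimit_iff_leaves :
    EnergyNotSigmaSquared.MoebiusLimit ↔
      HyperoctahedralRP.ExistsScaleCovariantLimit ∧ HyperoctahedralRP.InversionUpgradeNormalised :=
  MoebiusLimitExists_iff_leaves

/-- The glue for the spelling `AnomalousForcesInteraction.MoebiusLimit`. [cite: DuminilCopinICM2022, §8.4 p. 29] -/
theorem anomalousForces_MoebiusLimit_of_leaves
    (h1981 : HyperoctahedralRP.ExistsScaleCovariantLimit)
    (h1982 : HyperoctahedralRP.InversionUpgradeNormalised) :
    AnomalousForcesInteraction.MoebiusLimit :=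
  MoebiusLimitExists_of_leaves h1981 h1982

/-- The two-leaf factorisation for `AnomalousForcesInteraction.MoebiusLimit`. [cite: DuminilCopinICM2022, §8.4 p. 29] -/
theorem anomalousForces_MoebiusLimit_iff_leaves :
    AnomalousForcesInteraction.MoebiusLimit ↔
      HyperoctahedralRP.ExistsScaleCovariantLimit ∧ HyperoctahedralRP.InversionUpgradeNormalised :=
  MoebiusLimitExists_iff_leaves

/-- The glue for the spelling `GammaForcesInteraction.MoebiusLimit`. [cite: DuminilCopinICM2022, §8.4 p. 29] -/
theorem gammaForces_MoebiusLimit_of_leaves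
    (h1981 : HyperoctahedralRP.ExistsScaleCovariantLimit)
    (h1982 : HyperoctahedralRP.InversionUpgradeNormalised) :
    GammaForcesInteraction.MoebiusLimit :=
  MoebiusLimitExists_of_leaves h1981 h1982

/-- The two-leaf factorisation for `GammaForcesInteraction.MoebiusLimit`. [cite: DuminilCopinICM2022, §8.4 p. 29] -/
theorem gammaForces_MoebiusLimit_iff_leaves :
    GammaForcesInteraction.MoebiusLimit ↔
      HyperoctahedralRP.ExistsScaleCovariantLimit ∧ HyperoctahedralRP.InversionUpgradeNormalised :=
  MoebiusLimitExists_iff_leaves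

/-! ### Crux stmt-4801 `MoebiusLimitOfTwoPointLaw` -/

/-- **Two-leaf ASSEMBLY for crux stmt-4801 `MoebiusLimitOfTwoPointLaw`** (`BernsteinTemperature` spelling,
item 0634 → crux 1344): items 1981 and 1982 give it outright, the two-point-law hypothesis unused.
[cite: DuminilCopinICM2022, §8.4 p. 29] -/
theorem MoebiusLimitOfTwoPointLaw_of_leaves
    (h1981 : HyperoctahedralRP.ExistsScaleCovariantLimit)
    (h1982 : HyperoctahedralRP.InversionUpgradeNormalised) :
    BernsteinTemperature.MoebiusLimitOfTwoPointLaw :=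
  fun _ => MoebiusLimitExists_of_leaves h1981 h1982

/-- The same two-leaf assembly for the `PrecisionLaplacian` spelling of crux stmt-4801.
[cite: DuminilCopinICM2022, §8.4 p. 29] -/
theorem precisionLaplacian_MoebiusLimitOfTwoPointLaw_of_leaves
    (h1981 : HyperoctahedralRP.ExistsScaleCovariantLimit)
    (h1982 : HyperoctahedralRP.InversionUpgradeNormalised) :
    PrecisionLaplacian.MoebiusLimitOfTwoPointLaw :=
  fun _ => MoebiusLimitExists_of_leaves h1981 h1982

end Summit.CriticalPhenomena.Ising3DConformalLimit.MoebiusLimitExistsTwoLeaf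

end
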